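import Mathlib.RepresentationTheory.Subrepresentation
import Literature.NumberTheory.Automorphic.TwistedJacquetAdditive    -- ★ `TwistedJacquet.twistedSpan`, `twSum`, `exists_twistedSpan_ne_top` (stalks), `twSum_eq_zero_of_mem_twistedSpan`, `compOneParam`
import HarnessLib

/-!
# R90-TF · S4 «Ch. 13.1–2» — (ORBIT)∕(SWAP) support, part (e): DEGENERATE ⇒ `N`-TRIVIAL —
# if every non-trivially twisted space of coinvariants of a smooth one-parameter action vanishes, the action is trivial

Cell `hodgecm-mathlib`, crux H413 (`stmt-HodgeConjecture-24833`, lane `--supports … --as helper`), route of record `HCCMUnconditional`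
(no route verbs; count-neutral).  Programme R90-TF (brief `director/R90-BRIEF.v2.md` 1f40d54518340a35), section S4 = Rogawski Ch. 13.1–2
(base `R90-C131`); seat R90-C131-p01 (g0); hand «(e) DEGENERATE ⇒ N-TRIVIAL» (R90-C131-p03 (g0) 2026-09-04T16:27:47Z «p01 TAKE (c)(e)»;
census `R90/R90-C131-p01/g0/CENSUS-orbit.md` 62930f5ed58633f2) toward the Whittaker-model proof of (SWAP) (outer-similitude swap of the two
constituents of `i_{U(Φ₂)}(χ)`, `χ₁|F^× = ω`; [Rogawski1990, §11.1 p. 161]) ∕ socket S4#B5 `stub_R90_S4_H_lds`.  THEOREMS ONLY (no `def`,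
no instance, no notation, no named fact, no `sorry`); imports ★ `TwistedJacquetAdditive` only and speaks ITS currency: `F` a non-archimedean
local field, `ψ : AddChar F Circle` continuous non-trivial, `ρ` a representation of a group `G` on a complex space `V`, `e : F → G` a
one-parameter subgroup (`e (x + y) = e x * e y`) acting SMOOTHLY (`∀ v, ∃ s ≠ 0, ∀ x ∈ ball s, ρ (e x) v = v`), and
`V(ψ_a) = twistedSpan ρ e ψ a = ⟨ρ(e x) v - ψ(a x) v⟩` the kernel of the projection onto the `ψ_a`-twisted coinvariants `V_{F,ψ_a}`.

CONTENT.
* §1 THE OTHER HALF OF JACQUET'S LEMMA (finite-sum form): `P(a, R) v - |R| • v ∈ V(ψ_a)` for EVERY finite `R ⊂ F`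
  (`twSum_sub_card_smul_mem_twistedSpan`), hence `P(a, R) v = 0`, `R ≠ ∅` ⇒ `v ∈ V(ψ_a)` (`mem_twistedSpan_of_twSum_eq_zero`)
  [Bump1997, Prop. 4.4.1 (PDF p. 460); BernsteinZelevinskyRMS1976, Lemma 2.33].
* §2 LEFT EXACTNESS FOR AN `e`-STABLE SUBSPACE `W` (Bernstein–Zelevinsky [BernsteinZelevinskyASENS1977, Prop. 1.9 (a)]): a vector of `W` lying in
  `V(ψ_a)` lies in `W(ψ_a)` (the twisted span of the restricted action) — `W(ψ_a) = W ∩ V(ψ_a)` (`mem_twistedSpan_toRepresentation_of_mem`;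
  with ★ easy half `twSum_eq_zero_of_mem_twistedSpan` + §1).
* §3 **`apply_eq_self_of_forall_twistedSpan_eq_top`** — DEGENERATE ⇒ TRIVIAL: if `V(ψ_a) = V` for every `a ≠ 0` (all non-trivially twisted
  coinvariants vanish: «`V` is `ψ`-degenerate for every `ψ ≠ 1`»), then `ρ(e x) v = v` for all `x, v` (the one-parameter group acts trivially).
  Proof: `W := V(ψ_0) = ⟨ρ(e x) v - v⟩` is `e`-stable; by §2 EVERY twisted span of the restricted action on `W` is all of `W` (`a ≠ 0`: `V(ψ_a) = V`;
  `a = 0`: `V(ψ_0) = W`), so by the stalk theorem ★ `TwistedJacquet.exists_twistedSpan_ne_top` ([BernsteinZelevinskyASENS1977, §3.2 (e), 3.3 (b)];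
  [Bump1997, Prop. 4.4.5, proof of Thm. 4.4.3]) `W = 0`.
USE (census road (e)–(f)): a constituent of `i(χ)` which is generic for no `ψ ≠ 1` has trivial `N ≅ F_v`-action, which step (f) rules out in Keys'
case 2; with (c) ★ `Theorems/R90S4TwistedCoinvariantSlot` and (d) ★ STAB this forces the outer similitude to SWAP the two constituents.

HONEST LABEL: HC_CM is proved only modulo the 7 printed citations (2 remaining named inputs: hLiu418 = stmt-HodgeConjecture-24832,
h413 = stmt-HodgeConjecture-24833) until rung 0 closes; this file is representation-theoretic plumbing and discharges none of them.  REL ≠ ★ ≠ BUILT.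

## References
[BernsteinZelevinskyASENS1977] I. N. Bernstein, A. V. Zelevinsky, *Induced representations of reductive p-adic groups I*, Ann. Sci. ÉNS 10 (1977),
Prop. 1.9 (a), §3.2 (e), Remark 3.3 (b) · [BernsteinZelevinskyRMS1976] —, *Representations of the group GL(n, F)…*, Russian Math. Surveys 31 (1976),
Lemma 2.33, §5.11–5.15 · [Bump1997] D. Bump, *Automorphic Forms and Representations* (1997), Prop. 4.4.1, Prop. 4.4.5, Thm. 4.4.3 (PDF pp. 460–465) ·
[Rogawski1990] J. D. Rogawski, *Automorphic Representations of Unitary Groups in Three Variables* (1990), §11.1 p. 161.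
-/

set_option autoImplicit false
-- the mandated namespace (brief §3.4) repeats the single-problem summit's segment (`HodgeConjecture.HodgeConjecture`)
set_option linter.dupNamespace false

namespace Summit.HodgeConjecture.HodgeConjecture.R90.S4

open Literature.NumberTheory.Automorphic Literature.NumberTheory.Automorphic.TwistedJacquet
open ValuativeRel

section OneParam

variable {F : Type*} [Field F] [ValuativeRel F] [TopologicalSpace F] [IsNonarchimedeanLocalField F]
variable {G V : Type*} [Group G] [AddCommGroup V] [Module ℂ V]
  {ρ : Representation ℂ G V} {e : F → G} {ψ : AddChar F Circle}

/-! ## §1 The other half of Jacquet's lemma: `P(a, R) v - |R| v ∈ V(ψ_a)` -/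

omit [ValuativeRel F] [TopologicalSpace F] [IsNonarchimedeanLocalField F] in
/-- **`P(a, R) v - |R| • v ∈ V(ψ_a)`** for every finite `R ⊂ F`: each summand `ψ(-a r) ρ(e r) v - v = ψ(-a r) (ρ(e r) v - ψ(a r) v)` is a multiple of
a generator. [cite: Bump1997, Proposition 4.4.1 (PDF p. 460)] -/
theorem twSum_sub_card_smul_mem_twistedSpan (a : F) (R : Finset F) (v : V) :
    twSum ρ e ψ a R v - (R.card : ℂ) • v ∈ twistedSpan ρ e ψ a := by
  classical
  rw [twSum_apply]
  have hsum : ∑ r ∈ R, (ψ (-(a * r)) : ℂ) • ρ (e r) v - (R.card : ℂ) • v =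
      ∑ r ∈ R, ((ψ (-(a * r)) : ℂ) • ρ (e r) v - v) := by
    rw [Finset.sum_sub_distrib, Finset.sum_const, ← Nat.cast_smul_eq_nsmul ℂ]
  rw [hsum]
  refine Submodule.sum_mem _ fun r _ => ?_
  have hgen : (ψ (-(a * r)) : ℂ) • (ρ (e r) v - (ψ (a * r) : ℂ) • v) = (ψ (-(a * r)) : ℂ) • ρ (e r) v - v := by
    rw [smul_sub, smul_smul, AddChar.map_neg_eq_inv, Circle.coe_inv, inv_mul_cancel₀ (Circle.coe_ne_zero _), one_smul]
  rw [← hgen]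
  exact Submodule.smul_mem _ _ (sub_smul_mem_twistedSpan ρ e ψ a r v)

omit [ValuativeRel F] [TopologicalSpace F] [IsNonarchimedeanLocalField F] in
/-- **If `P(a, R) v = 0` for a non-empty finite `R`, then `v ∈ V(ψ_a)`** (`|R| • v ∈ V(ψ_a)`, `char ℂ = 0`).
[cite: Bump1997, Proposition 4.4.1 (PDF p. 460)] [cite: BernsteinZelevinskyASENS1977, Prop. 1.9 (a)] -/
theorem mem_twistedSpan_of_twSum_eq_zero {a : F} {R : Finset F} (hR : R.Nonempty) {v : V} (h0 : twSum ρ e ψ a R v = 0) :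
    v ∈ twistedSpan ρ e ψ a := by
  have h := twSum_sub_card_smul_mem_twistedSpan (ρ := ρ) (e := e) (ψ := ψ) a R v
  rw [h0, zero_sub, Submodule.neg_mem_iff] at h
  have hc : (R.card : ℂ) ≠ 0 := Nat.cast_ne_zero.2 (Finset.card_ne_zero.2 hR)
  exact (Submodule.smul_mem_iff _ hc).1 h

/-! ## §2 Left exactness for an `e`-stable subspace: `W(ψ_a) = W ∩ V(ψ_a)` -/

/-- **A vector of an `e`-stable subspace `W` lying in `V(ψ_a)` lies in `W(ψ_a)`** — the twisted span of the RESTRICTED one-parameter action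
`Multiplicative F → GL(W)` (★ `compOneParam`, `Subrepresentation.toRepresentation`): by the easy half of Jacquet's lemma (★
`twSum_eq_zero_of_mem_twistedSpan`) some average `P_B(a) w` vanishes in `V`, hence in `W`, hence `w ∈ W(ψ_a)` by §1.  This is Bernstein–Zelevinsky's
exactness of `r_{U,θ}` for the one-parameter `ℓ`-group `F`. [cite: BernsteinZelevinskyASENS1977, Prop. 1.9 (a)] [cite: Bump1997, Proposition 4.4.3 (PDF p. 462)] -/
theorem mem_twistedSpan_toRepresentation_of_mem (he : ∀ x y, e (x + y) = e x * e y)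
    (hsm : ∀ v : V, ∃ s : F, s ≠ 0 ∧ ∀ x ∈ ball s, ρ (e x) v = v) (hψ : ψ.IsContinuousNontrivial)
    (W : Subrepresentation (compOneParam (ρ := ρ) he)) (a : F) {w : ↥W.toSubmodule} (hw : (w : V) ∈ twistedSpan ρ e ψ a) :
    w ∈ twistedSpan W.toRepresentation (Multiplicative.ofAdd : F → Multiplicative F) ψ a := by
  -- level data for `ψ`, a lattice fixing `w` and small enough for `ψ(a ·)`
  obtain ⟨k₀, hk₀, hker, -⟩ := exists_level hψ
  obtain ⟨sw, hsw, hwfix⟩ := hsm (w : V)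
  -- `s₁` with `|s₁| ≤ |sw|` and `|a s₁| ≤ |k₀|`
  obtain ⟨s₁, hs₁, hs₁w, ha⟩ : ∃ s₁ : F, s₁ ≠ 0 ∧ valuation F s₁ ≤ valuation F sw ∧ valuation F (a * s₁) ≤ valuation F k₀ := by
    by_cases ha0 : a = 0
    · exact ⟨sw, hsw, le_rfl, by simp [ha0]⟩
    · obtain ⟨u, hu, hu1, hu2⟩ := exists_valuation_le_le sw (k₀ / a) hsw (div_ne_zero hk₀ ha0)
      refine ⟨u, hu, hu1, ?_⟩
      rw [map_mul]
      rw [map_div₀] at hu2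
      have ha' : 0 < valuation F a := zero_lt_iff.2 ((map_ne_zero _).2 ha0)
      calc valuation F a * valuation F u ≤ valuation F a * (valuation F k₀ / valuation F a) := mul_le_mul' le_rfl hu2
        _ = valuation F k₀ := mul_div_cancel₀ _ ha'.ne'
  have hwfix₁ : ∀ y ∈ ball s₁, ρ (e y) (w : V) = w := fun y hy => hwfix y (ball_mono hs₁w hy)
  obtain ⟨t₀, ht₀, hT⟩ := twSum_eq_zero_of_mem_twistedSpan he hsm hs₁ hker ha hw hwfix₁
  -- a common upper bound `t` and a transversal of `t𝒪 / s₁𝒪`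
  obtain ⟨t, ht, ht₀t, hs₁t⟩ := exists_valuation_ge_ge t₀ s₁ hs₁
  obtain ⟨R, hR⟩ := exists_isTransversal (ball_mono hs₁t) (isOpen_ball hs₁) (isCompact_ball t)
  have h0 : twSum ρ e ψ a R (w : V) = 0 := hT t ht₀t hs₁t R hR
  -- the same sum computed in `W`
  have h0W : twSum W.toRepresentation (Multiplicative.ofAdd : F → Multiplicative F) ψ a R w = 0 := by
    apply Subtype.ext
    rw [twSum_apply] at h0 ⊢
    rw [Submodule.coe_zero, ← h0, AddSubmonoidClass.coe_finsetSum]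
    refine Finset.sum_congr rfl fun r _ => ?_
    rfl
  exact mem_twistedSpan_of_twSum_eq_zero hR.nonempty h0W

/-! ## §3 Degenerate ⇒ trivial -/

omit [ValuativeRel F] [TopologicalSpace F] [IsNonarchimedeanLocalField F] in
/-- `V(ψ_0) = ⟨ρ(e x) v - v⟩` is `e`-stable: `ρ(e y)(ρ(e x) v - v) = (ρ(e (y + x)) v - v) - (ρ(e y) v - v)`. [cite: Bump1997, §4.4 (PDF p. 462)] -/
theorem apply_mem_twistedSpan_zero (he : ∀ x y, e (x + y) = e x * e y) (y : F) {v : V} (hv : v ∈ twistedSpan ρ e ψ 0) :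
    ρ (e y) v ∈ twistedSpan ρ e ψ 0 := by
  induction hv using Submodule.span_induction with
  | mem u hu =>
    obtain ⟨x, v, rfl⟩ := hu
    have h1 : ρ (e y) (ρ (e x) v - (ψ (0 * x) : ℂ) • v) =
        (ρ (e (y + x)) v - (ψ (0 * (y + x)) : ℂ) • v) - (ρ (e y) v - (ψ (0 * y) : ℂ) • v) := by
      simp only [zero_mul, AddChar.map_zero_eq_one, Circle.coe_one, one_smul, map_sub, apply_e_add he]
      abel
    rw [h1]
    exact Submodule.sub_mem _ (sub_smul_mem_twistedSpan ρ e ψ 0 (y + x) v) (sub_smul_mem_twistedSpan ρ e ψ 0 y v)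
  | zero => rw [map_zero]; exact Submodule.zero_mem _
  | add u u' _ _ hu hu' => rw [map_add]; exact Submodule.add_mem _ hu hu'
  | smul c u _ hu => rw [map_smul]; exact Submodule.smul_mem _ c hu

/-- **DEGENERATE ⇒ TRIVIAL.**  Let the one-parameter subgroup `e : F → G` act smoothly on `V` through `ρ`, and let `ψ` be continuous and
non-trivial.  If `V(ψ_a) = V` for every `a ≠ 0` — all NON-TRIVIALLY twisted coinvariants `V_{F,ψ_a}` vanish — then `ρ(e x) v = v` for all
`x ∈ F`, `v ∈ V`.  (The `e`-stable subspace `W = V(ψ_0)` has ALL its twisted coinvariants zero by left exactness (§2), so `W = 0` by the stalk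
theorem ★ `TwistedJacquet.exists_twistedSpan_ne_top`.)  For `N ≅ F_v` the unipotent radical of a Borel subgroup of `U(1,1)(F_v)`: an
irreducible representation which is `ψ`-generic for NO `ψ ≠ 1` has trivial `N`-action.
[cite: BernsteinZelevinskyASENS1977, §3.2 Proposition (e) and Remark 3.3 (b)] [cite: Bump1997, Proposition 4.4.5 (PDF p. 464)] -/
theorem apply_eq_self_of_forall_twistedSpan_eq_top (he : ∀ x y, e (x + y) = e x * e y)
    (hsm : ∀ v : V, ∃ s : F, s ≠ 0 ∧ ∀ x ∈ ball s, ρ (e x) v = v) (hψ : ψ.IsContinuousNontrivial)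
    (hdeg : ∀ a : F, a ≠ 0 → twistedSpan ρ e ψ a = ⊤) (x : F) (v : V) : ρ (e x) v = v := by
  -- `W = V(ψ_0)` as a subrepresentation of the one-parameter action
  let W : Subrepresentation (compOneParam (ρ := ρ) he) :=
    { toSubmodule := twistedSpan ρ e ψ 0
      apply_mem_toSubmodule := fun y _ hv => apply_mem_twistedSpan_zero he (Multiplicative.toAdd y) hv }
  -- every twisted span of the restricted action is all of `W`
  have hall : ∀ a : F, twistedSpan W.toRepresentation (Multiplicative.ofAdd : F → Multiplicative F) ψ a = ⊤ := by
    intro a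
    refine Submodule.eq_top_iff'.2 fun w => mem_twistedSpan_toRepresentation_of_mem he hsm hψ W a ?_
    by_cases ha : a = 0
    · subst ha
      exact w.2
    · rw [hdeg a ha]
      trivial
  -- hence `W = 0` by the stalk theorem
  have hW : twistedSpan ρ e ψ 0 = ⊥ := by
    by_contra hne
    haveI : Nontrivial ↥(twistedSpan ρ e ψ 0) := Submodule.nontrivial_iff_ne_bot.2 hne
    have hsm' : ∀ w : ↥W.toSubmodule, ∃ s : F, s ≠ 0 ∧
        ∀ y ∈ ball s, W.toRepresentation (Multiplicative.ofAdd y) w = w := by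
      intro w
      obtain ⟨s, hs, hfix⟩ := hsm (w : V)
      exact ⟨s, hs, fun y hy => Subtype.ext (hfix y hy)⟩
    obtain ⟨a, ha⟩ := exists_twistedSpan_ne_top (ρ := W.toRepresentation) (e := (Multiplicative.ofAdd : F → Multiplicative F))
      (ψ := ψ) (fun _ _ => rfl) hsm' hψ
    exact ha (hall a)
  -- so every generator `ρ(e x) v - v` vanishes
  have hmem : ρ (e x) v - (ψ (0 * x) : ℂ) • v ∈ twistedSpan ρ e ψ 0 := sub_smul_mem_twistedSpan ρ e ψ 0 x v
  rw [hW, Submodule.mem_bot, zero_mul, AddChar.map_zero_eq_one, Circle.coe_one, one_smul, sub_eq_zero] at hmem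
  exact hmem

end OneParam

end Summit.HodgeConjecture.HodgeConjecture.R90.S4
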